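import Literature.RingTheory.MvPowerSeries.AdicTaylor
import Mathlib.RingTheory.MvPowerSeries.Substitution
import HarnessLib

/-!
# `f(X + Y)`: the shift substitution of formal power series and the divided derivatives

Topic `Literature/RingTheory/MvPowerSeries`, companion of `AdicTaylor.lean`. For a formal power series
`f ∈ A⟦X_s : s ∈ τ⟧` (`τ` finite, `A` any commutative ring) the substitution `X_s ↦ X_s + Y_s` into the
power series ring in the two sets of variables `X = (X_{inl s})`, `Y = (X_{inr s})` (Mathlib
`MvPowerSeries.subst`, index type `τ ⊕ τ`) is legitimate (`hasSubst_X_inl_add_X_inr`) and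
**the coefficient of `X^β Y^α` in `f(X + Y)` is the coefficient of `X^β` in the divided derivative
`Δ_α f`** (`coeff_sumElim_subst_X_inl_add_X_inr`; Bourbaki, *Alg. Comm.* III §4 no. 5 formula (21):
`f(X + Y) = Σ_α Δ_α f(X) · Y^α`). `AdicTaylor.lean` DEFINES `hasseDeriv α = Δ_α` coefficientwise
(`coeff β (Δ_α f) = C(α+β, α) f_{α+β}`) and proves the Taylor expansion at a topologically nilpotent point;
the present file supplies the identification with Mathlib's substitution API that was left implicit there.
On the way: the monomial bookkeeping `Π X_{inl s}^{γ_s} · Π X_{inr s}^{δ_s} = X^{(γ,δ)}`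
(`prod_X_inl_pow_mul_prod_X_inr_pow`, exponent `Finsupp.sumElim γ δ`) and the coefficients of
`Π_s (X_{inl s} + X_{inr s})^{d_s}` (`coeff_sumElim_prod_X_inl_add_X_inr_pow`).

Everything here is PROVED; no definitions, no named facts. Consumer (index only): the res-hironaka campaign's
typed Taylor expansion `S03DiffARNE.taylor` / partial derivatives `S03DiffARNE.hassePartial` (H. Hironaka 2017
ms., Def. 3.3) are this substitution and these coefficients for `τ = Fin n` over a field.

## References

* N. Bourbaki, *Algèbre commutative*, Ch. III §4 no. 5, formula (21). [Bourbaki1989CommAlg]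
-/

noncomputable section

namespace Literature.RingTheory.MvPowerSeries

open _root_.MvPowerSeries Finset

universe u v v'

variable {A : Type u} [CommRing A] {τ : Type v} {τ' : Type v'}

/-! ### Monomials in two sets of variables -/

/-- `Σ_s e_{inl s} γ_s + Σ_s e_{inr s} δ_s` is the exponent `(γ, δ)` on `τ ⊕ τ'` (plumbing). [folklore] -/
private theorem sum_single_inl_add_sum_single_inr [Fintype τ] [Fintype τ'] (γ : τ →₀ ℕ) (δ : τ' →₀ ℕ) :
    ((∑ s, Finsupp.single (Sum.inl s) (γ s)) + ∑ s, Finsupp.single (Sum.inr s) (δ s) :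
      τ ⊕ τ' →₀ ℕ) = γ.sumElim δ := by
  classical
  ext i
  rcases i with i | i <;>
    simp [Finsupp.single_apply]

/-- `(γ, δ) = (β, α)` as exponents on `τ ⊕ τ'` iff `γ = β` and `δ = α` (plumbing). [folklore] -/
private theorem sumElim_eq_sumElim_iff (γ β : τ →₀ ℕ) (δ α : τ' →₀ ℕ) :
    γ.sumElim δ = β.sumElim α ↔ γ = β ∧ δ = α := by
  constructor
  · intro h
    refine ⟨Finsupp.ext fun i => ?_, Finsupp.ext fun i => ?_⟩
    · simpa only [Finsupp.sumElim_inl] using DFunLike.congr_fun h (Sum.inl i)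
    · simpa only [Finsupp.sumElim_inr] using DFunLike.congr_fun h (Sum.inr i)
  · rintro ⟨rfl, rfl⟩
    rfl

/-- **Monomials in two sets of variables**: `Π_s X_{inl s}^{γ_s} · Π_s X_{inr s}^{δ_s} = X^{(γ, δ)}`
in `A⟦X_{inl s}, X_{inr s'}⟧` — the monomials `X^β Y^α` of Bourbaki's `A⟦X, Y⟧` in which `f(X + Y)` is
expanded. [cite: Bourbaki1989CommAlg, Ch. III §4 no. 5 (21)] -/
theorem prod_X_inl_pow_mul_prod_X_inr_pow [Fintype τ] [Fintype τ'] (γ : τ →₀ ℕ) (δ : τ' →₀ ℕ) :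
    ((∏ s, (X (Sum.inl s) : MvPowerSeries (τ ⊕ τ') A) ^ γ s) *
        ∏ s, (X (Sum.inr s) : MvPowerSeries (τ ⊕ τ') A) ^ δ s) =
      monomial (γ.sumElim δ) 1 := by
  simp_rw [X_pow_eq]
  rw [prod_monomial, prod_monomial, monomial_mul_monomial, Finset.prod_const_one,
    Finset.prod_const_one, one_mul, sum_single_inl_add_sum_single_inr]

/-! ### Coefficients of `Π_s (X_s + Y_s)^{d_s}` and of `f(X + Y)` -/

section Shift

variable [Fintype τ] [DecidableEq τ]

/-- **Binomial coefficients of `Π_s (X_{inl s} + X_{inr s})^{d_s}`**: the coefficient of `X^β Y^α`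
(`X = X ∘ inl`, `Y = X ∘ inr`) is `Π_s C(d_s, α_s)` if `d = α + β` and `0` otherwise.
[cite: Bourbaki1989CommAlg, Ch. III §4 no. 5 (21)] -/
theorem coeff_sumElim_prod_X_inl_add_X_inr_pow (α β d : τ →₀ ℕ) :
    coeff (β.sumElim α) (∏ s, ((X (Sum.inl s) : MvPowerSeries (τ ⊕ τ) A) + X (Sum.inr s)) ^ d s) =
      if d = α + β then ((∏ s, (d s).choose (α s) : ℕ) : A) else 0 := by
  classical
  rw [prod_add_pow_eq_sum (fun s => (X (Sum.inl s) : MvPowerSeries (τ ⊕ τ) A))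
    (fun s => X (Sum.inr s)) d, map_sum]
  -- each summand `C(d, γ) · X^γ Y^{d-γ}` is a monomial with exponent `(γ, d - γ)`
  have hterm : ∀ γ : τ →₀ ℕ,
      coeff (β.sumElim α) ((∏ s, (((d s).choose (γ s) : ℕ) : MvPowerSeries (τ ⊕ τ) A)) *
        ((∏ s, (X (Sum.inl s) : MvPowerSeries (τ ⊕ τ) A) ^ γ s) *
          ∏ s, (X (Sum.inr s) : MvPowerSeries (τ ⊕ τ) A) ^ (d s - γ s))) =
        if γ = β ∧ d - γ = α then ((∏ s, (d s).choose (γ s) : ℕ) : A) else 0 := by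
    intro γ
    have hpow : (∏ s, (X (Sum.inr s) : MvPowerSeries (τ ⊕ τ) A) ^ (d s - γ s)) =
        ∏ s, (X (Sum.inr s) : MvPowerSeries (τ ⊕ τ) A) ^ (d - γ) s :=
      Finset.prod_congr rfl fun s _ => by rw [Finsupp.tsub_apply]
    rw [hpow, prod_X_inl_pow_mul_prod_X_inr_pow, ← Nat.cast_prod, ← map_natCast (C (σ := τ ⊕ τ)),
      coeff_C_mul, coeff_monomial]
    by_cases h : γ = β ∧ d - γ = α
    · rw [if_pos ((sumElim_eq_sumElim_iff β γ α (d - γ)).mpr ⟨h.1.symm, h.2.symm⟩), mul_one, if_pos h]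
    · rw [if_neg fun h' => h ⟨((sumElim_eq_sumElim_iff β γ α (d - γ)).mp h').1.symm,
        ((sumElim_eq_sumElim_iff β γ α (d - γ)).mp h').2.symm⟩, mul_zero, if_neg h]
  simp_rw [hterm]
  by_cases hd : d = α + β
  · -- the term `γ = β` is present and is the only survivor
    subst hd
    rw [Finset.sum_eq_single_of_mem β (Finset.mem_Iic.mpr le_add_self)]
    · rw [if_pos ⟨rfl, add_tsub_cancel_right α β⟩, if_pos rfl]
      congr 1
      push_cast
      exact Finset.prod_congr rfl fun s _ => by
        rw [Pi.add_apply, Nat.choose_symm_add]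
    · intro γ _ hγ
      rw [if_neg fun h => hγ h.1]
  · rw [if_neg hd]
    refine Finset.sum_eq_zero fun γ hγ => ?_
    rw [Finset.mem_Iic] at hγ
    rw [if_neg]
    rintro ⟨rfl, h2⟩
    exact hd (by rw [← h2, tsub_add_cancel_of_le hγ])

omit [DecidableEq τ] in
/-- The shift substitution `X_s ↦ X_{inl s} + X_{inr s}` defining `f(X + Y)` is legitimate (its constant
coefficients vanish, Bourbaki's condition for substitution into formal power series, loc. cit. no. 5).
[cite: Bourbaki1989CommAlg, Ch. III §4 no. 5 (21)] -/
theorem hasSubst_X_inl_add_X_inr :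
    HasSubst (fun s : τ => (X (Sum.inl s) : MvPowerSeries (τ ⊕ τ) A) + X (Sum.inr s)) :=
  hasSubst_of_constantCoeff_zero fun s => by simp

/-- **Bourbaki's formula (21): the coefficients of `f(X + Y)` are the divided derivatives.** For
`f ∈ A⟦X_s : s ∈ τ⟧`, the coefficient of `X^β Y^α` in `f(X + Y) := subst (X_s ↦ X_{inl s} + X_{inr s}) f`
is the coefficient of `X^β` in `Δ_α f = hasseDeriv α f`, i.e. `f(X + Y) = Σ_α (Δ_α f)(X) Y^α`.
[cite: Bourbaki1989CommAlg, Ch. III §4 no. 5 (21)] -/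
theorem coeff_sumElim_subst_X_inl_add_X_inr (f : MvPowerSeries τ A) (α β : τ →₀ ℕ) :
    coeff (β.sumElim α)
        (subst (fun s : τ => (X (Sum.inl s) : MvPowerSeries (τ ⊕ τ) A) + X (Sum.inr s)) f) =
      coeff β (hasseDeriv α f) := by
  classical
  rw [coeff_subst hasSubst_X_inl_add_X_inr, coeff_hasseDeriv]
  simp_rw [Finsupp.prod_pow, coeff_sumElim_prod_X_inl_add_X_inr_pow]
  rw [finsum_eq_single _ (α + β) fun d hd => by rw [if_neg hd, smul_zero], if_pos rfl, smul_eq_mul,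
    mul_comm, prod_choose_eq]
  congr 2

/-- Coefficientwise form of `f(X + Y) = Σ_α (Δ_α f)(X) Y^α` at an arbitrary exponent `e` of `τ ⊕ τ`
(split as `e = (e ∘ inl, e ∘ inr)`). [cite: Bourbaki1989CommAlg, Ch. III §4 no. 5 (21)] -/
theorem coeff_subst_X_inl_add_X_inr (f : MvPowerSeries τ A) (e : τ ⊕ τ →₀ ℕ) :
    coeff e (subst (fun s : τ => (X (Sum.inl s) : MvPowerSeries (τ ⊕ τ) A) + X (Sum.inr s)) f) =
      coeff (e.comapDomain Sum.inl Sum.inl_injective.injOn)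
        (hasseDeriv (e.comapDomain Sum.inr Sum.inr_injective.injOn) f) := by
  rw [← coeff_sumElim_subst_X_inl_add_X_inr, Finsupp.comapDomain_sumElim_comapDomain]

end Shift

end Literature.RingTheory.MvPowerSeries
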